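import Mathlib.Analysis.SpecialFunctions.Trigonometric.Inverse
import Mathlib.Topology.UniformSpace.UniformApproximation
import Literature.Analysis.FluidPDE.KNSSTypeII
import HarnessLib

/-!
# KNSS 2009, proof of Theorem 6.2, Step 5 (part): a locally uniform limit of fields
# axisymmetric about receding axes does not depend on `x₂` (proved)

Analysis/FluidPDE support file (all results proved) for the decomposition of
`Literature.Analysis.FluidPDE.KNSS2009_regularity_typeI_rate` (`KNSSTypeII`; Koch–Nadirashvili–
Seregin–Šverák, Acta Math. 203 (2009) = arXiv:0709.3599, Theorem 6.2; `KNSSTypeIRate`, module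
docstring, Step 5). In the printed proof (arXiv p. 13) the doubly rescaled fields `w⁽ᵏ⁾` are
axisymmetric about the vertical axis through `c_k = −M_k e₁`, `M_k ↗ ∞`, and the authors note:
"since the solutions `v⁽ᵏ⁾` are axi-symmetric and `M_k ↗ ∞`, it is easy to see that `w` is
independent of the `x₂`-variable" for the locally uniform limit `w`. This file proves that
elementary statement, slice by slice, independently of any solution concept:

* `rotZ_receding_axis_tendsto`: for `θ_k = arcsin(δ/(x₁ + M_k))` the rotated points
  `c_k + R_{θ_k}(x − c_k)` converge to `x + δ e₂` and `θ_k → 0`;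
* `eq_of_tendstoLocallyUniformly_of_rot_about` : if `W_k → w` locally uniformly on `ℝ³`, `w` is
  continuous, and each `W_k` is axisymmetric about the axis through `c_k`, then
  `w(x + δ e₂) = w(x)` for all `x`, `δ`.

It is one of the ingredients compressed into the named fact
`KNSS2009_typeI_rate_blowupSequence` (`KNSSTypeIRate`), recorded here for its eventual discharge.

## References

* G. Koch, N. Nadirashvili, G. Seregin, V. Šverák, Acta Math. 203 (2009) 83–105 =
  arXiv:0709.3599, proof of Theorem 6.2, p. 13. [KochNadirashviliSereginSverak2009]
-/

noncomputable section

open Set Function Filter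
open _root_.Topology

namespace Literature.Analysis.FluidPDE

/-! ### Continuity of the rotations in the angle and the vector -/

/-- `(θ, v) ↦ R_θ v` is continuous. [folklore] -/
theorem continuous_rotZ_uncurry :
    Continuous fun p : ℝ × EuclideanSpace ℝ (Fin 3) => rotZ p.1 p.2 := by
  unfold rotZ
  refine (PiLp.continuous_toLp 2 _).comp ?_
  refine continuous_pi fun i => ?_
  have h0 : Continuous fun p : ℝ × EuclideanSpace ℝ (Fin 3) => p.2 0 :=
    (PiLp.continuous_apply 2 _ 0).comp continuous_snd
  have h1 : Continuous fun p : ℝ × EuclideanSpace ℝ (Fin 3) => p.2 1 :=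
    (PiLp.continuous_apply 2 _ 1).comp continuous_snd
  have h2 : Continuous fun p : ℝ × EuclideanSpace ℝ (Fin 3) => p.2 2 :=
    (PiLp.continuous_apply 2 _ 2).comp continuous_snd
  have hc : Continuous fun p : ℝ × EuclideanSpace ℝ (Fin 3) => Real.cos p.1 :=
    Real.continuous_cos.comp continuous_fst
  have hs : Continuous fun p : ℝ × EuclideanSpace ℝ (Fin 3) => Real.sin p.1 :=
    Real.continuous_sin.comp continuous_fst
  fin_cases i
  · exact ((hc.mul h0).sub (hs.mul h1)).congr fun p => by simp
  · exact ((hs.mul h0).add (hc.mul h1)).congr fun p => by simp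
  · exact h2.congr fun p => by simp

/-! ### The rotated points about a receding axis -/

/-- `1 − √(1 − y²) ≤ y²` for `|y| ≤ 1` (since `√s ≥ s` on `[0, 1]`), and `0 ≤ 1 − √(1 − y²)`. [folklore] -/
theorem one_sub_sqrt_one_sub_sq_le {y : ℝ} (hy : |y| ≤ 1) :
    0 ≤ 1 - Real.sqrt (1 - y ^ 2) ∧ 1 - Real.sqrt (1 - y ^ 2) ≤ y ^ 2 := by
  have hy2 : y ^ 2 ≤ 1 := by
    have := abs_le.1 hy
    nlinarith
  have hs0 : 0 ≤ 1 - y ^ 2 := by linarith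
  have hs1 : 1 - y ^ 2 ≤ 1 := by nlinarith
  constructor
  · have : Real.sqrt (1 - y ^ 2) ≤ 1 := by
      rw [Real.sqrt_le_one]
      exact hs1
    linarith
  · -- `s ≤ √s` for `s ∈ [0, 1]`
    have : 1 - y ^ 2 ≤ Real.sqrt (1 - y ^ 2) := by
      conv_lhs => rw [← Real.sqrt_sq hs0]
      exact Real.sqrt_le_sqrt (by nlinarith)
    linarith

/-- **The rotated points converge.** Let `M_k → ∞`, `x ∈ ℝ³`, `δ ∈ ℝ`, `a_k = x₁ + M_k` and
`θ_k = arcsin(δ/a_k)`. Then `θ_k → 0` and the points `c_k + R_{θ_k}(x − c_k)`, `c_k = −M_k e₁`,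
converge to `x + δ e₂` (their coordinates are `x₁ + a_k(cos θ_k − 1) − x₂ sin θ_k`,
`δ + x₂ cos θ_k`, `x₃`, and `a_k(1 − cos θ_k) ≤ δ²/a_k → 0`). [folklore] -/
theorem rotZ_receding_axis_tendsto {M : ℕ → ℝ} (hM : Tendsto M atTop atTop)
    (x : EuclideanSpace ℝ (Fin 3)) (δ : ℝ) :
    Tendsto (fun k => Real.arcsin (δ / (x 0 + M k))) atTop (𝓝 0) ∧
    Tendsto (fun k => (EuclideanSpace.single 0 (-M k) : EuclideanSpace ℝ (Fin 3)) +
      rotZ (Real.arcsin (δ / (x 0 + M k))) (x - EuclideanSpace.single 0 (-M k))) atTop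
      (𝓝 (x + EuclideanSpace.single 1 δ)) := by
  set a : ℕ → ℝ := fun k => x 0 + M k with ha
  have ha_top : Tendsto a atTop atTop := tendsto_atTop_add_const_left _ _ hM
  have hy : Tendsto (fun k => δ / a k) atTop (𝓝 0) := tendsto_const_nhds.div_atTop ha_top
  have hθ : Tendsto (fun k => Real.arcsin (δ / a k)) atTop (𝓝 0) := by
    have := (Real.continuous_arcsin.tendsto 0).comp hy
    rwa [Real.arcsin_zero] at this
  refine ⟨hθ, ?_⟩
  have hcos : Tendsto (fun k => Real.cos (Real.arcsin (δ / a k))) atTop (𝓝 1) := by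
    have := (Real.continuous_cos.tendsto 0).comp hθ
    rwa [Real.cos_zero] at this
  have hsin : Tendsto (fun k => Real.sin (Real.arcsin (δ / a k))) atTop (𝓝 0) := by
    have := (Real.continuous_sin.tendsto 0).comp hθ
    rwa [Real.sin_zero] at this
  -- eventually `a k ≥ |δ| + 1 > 0`, so `|δ / a k| ≤ 1` and `sin θ_k = δ / a k`
  have hev : ∀ᶠ k in atTop, |δ| + 1 ≤ a k := ha_top.eventually_ge_atTop _
  -- the key small quantity `a k * (cos θ_k - 1) → 0`
  have hsmall : Tendsto (fun k => a k * (Real.cos (Real.arcsin (δ / a k)) - 1)) atTop (𝓝 0) := by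
    have hbound : ∀ᶠ k in atTop, |a k * (Real.cos (Real.arcsin (δ / a k)) - 1)| ≤ δ ^ 2 / a k := by
      filter_upwards [hev] with k hk
      have hak : 0 < a k := by linarith [abs_nonneg δ]
      have hy1 : |δ / a k| ≤ 1 := by
        rw [abs_div, abs_of_pos hak, div_le_one hak]
        linarith
      obtain ⟨h1, h2⟩ := one_sub_sqrt_one_sub_sq_le hy1
      rw [Real.cos_arcsin, abs_mul, abs_of_pos hak,
        show Real.sqrt (1 - (δ / a k) ^ 2) - 1 = -(1 - Real.sqrt (1 - (δ / a k) ^ 2)) by ring,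
        abs_neg, abs_of_nonneg h1]
      calc a k * (1 - Real.sqrt (1 - (δ / a k) ^ 2)) ≤ a k * (δ / a k) ^ 2 :=
            mul_le_mul_of_nonneg_left h2 hak.le
        _ = δ ^ 2 / a k := by field_simp
    have hlim : Tendsto (fun k => δ ^ 2 / a k) atTop (𝓝 0) := tendsto_const_nhds.div_atTop ha_top
    exact squeeze_zero_norm' (by simpa [Real.norm_eq_abs] using hbound) hlim
  -- componentwise description of the rotated point minus its limit
  have hrepr : ∀ k, (EuclideanSpace.single 0 (-M k) : EuclideanSpace ℝ (Fin 3)) +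
      rotZ (Real.arcsin (δ / (x 0 + M k))) (x - EuclideanSpace.single 0 (-M k)) -
        (x + EuclideanSpace.single 1 δ) =
      EuclideanSpace.single 0 (a k * (Real.cos (Real.arcsin (δ / a k)) - 1) -
          x 1 * Real.sin (Real.arcsin (δ / a k))) +
        EuclideanSpace.single 1 (a k * Real.sin (Real.arcsin (δ / a k)) - δ +
          x 1 * (Real.cos (Real.arcsin (δ / a k)) - 1)) := by
    intro k
    ext i
    fin_cases i <;> simp [ha] <;> ring
  -- the second coordinate error `a k sin θ_k - δ` vanishes eventually
  have hsec : ∀ᶠ k in atTop, a k * Real.sin (Real.arcsin (δ / a k)) - δ = 0 := by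
    filter_upwards [hev] with k hk
    have hak : 0 < a k := by linarith [abs_nonneg δ]
    have hle := abs_le.1 (show |δ / a k| ≤ 1 by
      rw [abs_div, abs_of_pos hak, div_le_one hak]; linarith)
    rw [Real.sin_arcsin hle.1 hle.2]
    field_simp
    ring
  -- conclude: the difference tends to `0`
  rw [tendsto_iff_norm_sub_tendsto_zero]
  have h1 : Tendsto (fun k => a k * (Real.cos (Real.arcsin (δ / a k)) - 1) -
      x 1 * Real.sin (Real.arcsin (δ / a k))) atTop (𝓝 0) := by
    simpa using hsmall.sub (hsin.const_mul (x 1))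
  have h2 : Tendsto (fun k => a k * Real.sin (Real.arcsin (δ / a k)) - δ +
      x 1 * (Real.cos (Real.arcsin (δ / a k)) - 1)) atTop (𝓝 0) := by
    have h2a : Tendsto (fun k => a k * Real.sin (Real.arcsin (δ / a k)) - δ) atTop (𝓝 0) :=
      tendsto_const_nhds.congr' (hsec.mono fun k hk => hk.symm)
    have h2b : Tendsto (fun k => x 1 * (Real.cos (Real.arcsin (δ / a k)) - 1)) atTop (𝓝 0) := by
      simpa using (hcos.sub_const 1).const_mul (x 1)
    simpa using h2a.add h2b
  have h3 : Tendsto (fun k => ‖a k * (Real.cos (Real.arcsin (δ / a k)) - 1) -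
      x 1 * Real.sin (Real.arcsin (δ / a k))‖ + ‖a k * Real.sin (Real.arcsin (δ / a k)) - δ +
      x 1 * (Real.cos (Real.arcsin (δ / a k)) - 1)‖) atTop (𝓝 0) := by
    have := h1.norm.add h2.norm
    rwa [norm_zero, add_zero] at this
  refine squeeze_zero (fun k => norm_nonneg _) (fun k => ?_) h3
  rw [hrepr k]
  refine (norm_add_le _ _).trans (le_of_eq ?_)
  simp

/-! ### Independence of `x₂` in the limit -/

/-- **KNSS 2009, proof of Theorem 6.2, p. 13: "it is easy to see that `w` is independent of
the `x₂`-variable."** Let `M_k → ∞` and let `W_k : ℝ³ → ℝ³` be axisymmetric about the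
vertical axis through `c_k = −M_k e₁`, `W_k(c_k + R_θ(x − c_k)) = R_θ W_k(x)`. If `W_k → w`
locally uniformly and `w` is continuous, then `w(x + δ e₂) = w(x)` for all `x` and `δ`: with
`θ_k = arcsin(δ/(x₁ + M_k)) → 0` the points `z_k = c_k + R_{θ_k}(x − c_k)` tend to `x + δ e₂`
(`rotZ_receding_axis_tendsto`), so `W_k(z_k) → w(x + δ e₂)` by locally uniform convergence,
while `W_k(z_k) = R_{θ_k} W_k(x) → R_0 w(x) = w(x)`. (Slice-wise statement; for the space–time
fields of the proof apply it at each time.) [cite: KochNadirashviliSereginSverak2009, proof of Thm 6.2 (arXiv p. 13)] -/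
theorem eq_of_tendstoLocallyUniformly_of_rot_about {M : ℕ → ℝ} (hM : Tendsto M atTop atTop)
    {W : ℕ → EuclideanSpace ℝ (Fin 3) → EuclideanSpace ℝ (Fin 3)}
    {w : EuclideanSpace ℝ (Fin 3) → EuclideanSpace ℝ (Fin 3)}
    (hsym : ∀ k (θ : ℝ) (x : EuclideanSpace ℝ (Fin 3)),
      W k (EuclideanSpace.single 0 (-M k) + rotZ θ (x - EuclideanSpace.single 0 (-M k))) =
        rotZ θ (W k x))
    (hconv : TendstoLocallyUniformly W w atTop) (hw : Continuous w)
    (x : EuclideanSpace ℝ (Fin 3)) (δ : ℝ) :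
    w (x + EuclideanSpace.single 1 δ) = w x := by
  obtain ⟨hθ, hz⟩ := rotZ_receding_axis_tendsto hM x δ
  -- left-hand side: `W k (z k) → w (x + δ e₂)`
  have hL : Tendsto (fun k => W k ((EuclideanSpace.single 0 (-M k) : EuclideanSpace ℝ (Fin 3)) +
      rotZ (Real.arcsin (δ / (x 0 + M k))) (x - EuclideanSpace.single 0 (-M k)))) atTop
      (𝓝 (w (x + EuclideanSpace.single 1 δ))) :=
    hconv.tendsto_comp hw.continuousAt hz
  -- right-hand side: `R_{θ k} (W k x) → R_0 (w x) = w x`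
  have hWx : Tendsto (fun k => W k x) atTop (𝓝 (w x)) :=
    hconv.tendsto_comp hw.continuousAt tendsto_const_nhds
  have hR : Tendsto (fun k => rotZ (Real.arcsin (δ / (x 0 + M k))) (W k x)) atTop (𝓝 (w x)) := by
    have := (continuous_rotZ_uncurry.tendsto (0, w x)).comp (hθ.prodMk_nhds hWx)
    simpa [Function.comp_def, rotZ_zero] using this
  have heq : (fun k => W k ((EuclideanSpace.single 0 (-M k) : EuclideanSpace ℝ (Fin 3)) +
      rotZ (Real.arcsin (δ / (x 0 + M k))) (x - EuclideanSpace.single 0 (-M k)))) =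
      fun k => rotZ (Real.arcsin (δ / (x 0 + M k))) (W k x) := funext fun k => hsym k _ x
  rw [heq] at hL
  exact tendsto_nhds_unique hL hR

end Literature.Analysis.FluidPDE

end
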